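import Mathlib
import Summits.ValiantsHypothesis.ValiantsHypothesis.Theorems.RigidityForcesSymmetryRankRigidMinimalReprLaplaceFiveTilings
import Summits.ValiantsHypothesis.ValiantsHypothesis.Theorems.RigidityForcesSymmetryRankRigidMinimalReprLaplaceFiveSectorSplit

/-!
# Young-shadow separation on three pair splits, I — the CROSS-SWAP lemma and all non-triangle triples
# (crux `RankRigidMinimalRepr`, stmt-ValiantsHypothesis-18034; frontier rung `LaplaceOptimalFive`, stmt-24813; toward the stub
#  `stub_threeSplit_separation` of crux idea #6 `young-shadow`, `Cruxes/LaplaceOptimalFive/YoungShadowSketch.lean` §2, and the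
#  registered stub S2′ `stub_sideSym_offShell_five` of the line `shallow_collision` rev 4)

Vocabulary from `…LaplaceFiveSectorSplitDefs.lean` (`SlotInvariantOn`, `InvUnder`); slot permutations act on a tensor
`T : (Fin 5 → Fin 5) → ℂ` by `(τ • T) v = T (v ∘ τ)`.

* `full_of_crossSwap` — **CROSS-SWAP LEMMA**: a tensor invariant under the slot swaps inside `S`, inside `Sᶜ` and under ONE
  cross swap `(c d)` (`c ∈ S`, `d ∉ S`) is fully slot-symmetric (every cross swap is a conjugate of `(c d)` by inside swaps; then
  `Equiv.Perm.swap_induction_on`).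
* `full_of_role` — ELIMINATION: for three tensors `Z₁, Z₂, Z₃`, `Z_k` symmetric within both sides of the split `S_k`, with
  `Z₁ + Z₂ + Z₃` fully symmetric, a cross swap of `S₃` that stabilises `S₁` and `S₂` makes `Z₃` fully symmetric (subtract the sum
  at `v` and `v ∘ (c d)`); `full_of_other_two` — the third shadow is symmetric once two are.
* `nonTriangle_roles` (kernel, `decide`): among three distinct pair splits that are NOT the three sides of a triangle, every split
  has such a cross swap or the other two do (census: 80 of the 120 triples have one for all three roles, the 30 of type `P₃ ⊔ K₂`
  for two, the 10 triangles for none).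
* `threeSplit_separation_of_not_triangle` — **separation for every non-triangle triple of distinct pair splits**: the three
  shadows of a fully symmetric sum are fully symmetric.  The triangle `{pa, pb, ab}` is the companion file's business.

Exhaustive arithmetic check before typing (`work/explore/threesplit.py`, exact rank mod two primes): for each of the 126 letter
contents × 120 triples the solutions of «`Z_k` `Stab(S_k)`-invariant, `Σ Z_k` constant» are exactly the constants (dimension 3).
HONEST FRAMING: a lemma toward young-shadow K1 / S2′; `LaplaceOptimalFive` (stmt-24813) stays OPEN · CONTESTED 72/120; nothing here
bears on `VP ≠ VNP`, which is NOT proved.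
-/

set_option autoImplicit false

-- the mandated summit-side namespace repeats a component by design (single-problem summit)
set_option linter.dupNamespace false

namespace Summit.ValiantsHypothesis.ValiantsHypothesis.Theorems.RigidityForcesSymmetryRankRigidMinimalRepr

namespace LaplaceFiveSectorSplit

open Finset
open LaplaceFiveTilings (pairOf idxOf pairOf_idxOf)

/-! ### §1 Algebra of invariance -/

/-- The identity permutation acts trivially. -/
theorem invUnder_one (T : (Fin 5 → Fin 5) → ℂ) : InvUnder 1 T := fun v => by simp

/-- Invariance passes to the inverse permutation. -/
theorem invUnder_inv {τ : Equiv.Perm (Fin 5)} {T : (Fin 5 → Fin 5) → ℂ} (h : InvUnder τ T) : InvUnder τ⁻¹ T := by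
  intro v
  have h' := h (v ∘ ⇑τ⁻¹)
  have hc : (v ∘ ⇑τ⁻¹) ∘ ⇑τ = v := funext fun i => by simp
  rw [hc] at h'
  exact h'.symm

/-- Invariance of a sum of invariant tensors. -/
theorem invUnder_add {τ : Equiv.Perm (Fin 5)} {T₁ T₂ : (Fin 5 → Fin 5) → ℂ} (h1 : InvUnder τ T₁) (h2 : InvUnder τ T₂) :
    InvUnder τ (T₁ + T₂) := fun v => by simp only [Pi.add_apply, h1 v, h2 v]

/-- Invariance of a conjugate `σ τ σ⁻¹`. -/
theorem invUnder_conj {σ τ : Equiv.Perm (Fin 5)} {T : (Fin 5 → Fin 5) → ℂ} (hσ : InvUnder σ T) (hτ : InvUnder τ T) :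
    InvUnder (σ * τ * σ⁻¹) T :=
  invUnder_mul (invUnder_mul hσ hτ) (invUnder_inv hσ)

/-- `SlotInvariantOn` is closed under addition. -/
theorem slotInvariantOn_add {A : Finset (Fin 5)} {T₁ T₂ : (Fin 5 → Fin 5) → ℂ} (h1 : SlotInvariantOn A T₁)
    (h2 : SlotInvariantOn A T₂) : SlotInvariantOn A (T₁ + T₂) :=
  fun τ hτ v => by simp only [Pi.add_apply, h1 τ hτ v, h2 τ hτ v]

/-- `SlotInvariantOn` is closed under negation. -/
theorem slotInvariantOn_neg {A : Finset (Fin 5)} {T : (Fin 5 → Fin 5) → ℂ} (h : SlotInvariantOn A T) :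
    SlotInvariantOn A (-T) :=
  fun τ hτ v => by simp only [Pi.neg_apply, h τ hτ v]

/-- `SlotInvariantOn` is closed under subtraction. -/
theorem slotInvariantOn_sub {A : Finset (Fin 5)} {T₁ T₂ : (Fin 5 → Fin 5) → ℂ} (h1 : SlotInvariantOn A T₁)
    (h2 : SlotInvariantOn A T₂) : SlotInvariantOn A (T₁ - T₂) :=
  fun τ hτ v => by simp only [Pi.sub_apply, h1 τ hτ v, h2 τ hτ v]

/-- Full symmetry from invariance under every transposition. -/
theorem slotInvariantOn_univ_of_swaps {T : (Fin 5 → Fin 5) → ℂ}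
    (h : ∀ x y : Fin 5, x ≠ y → InvUnder (Equiv.swap x y) T) : SlotInvariantOn Finset.univ T := by
  have hall : ∀ τ : Equiv.Perm (Fin 5), InvUnder τ T := by
    intro τ
    induction τ using Equiv.Perm.swap_induction_on with
    | one => intro v; simp
    | swap_mul f x y hxy ih => exact invUnder_mul (h x y hxy) ih
  exact fun τ _ v => hall τ v

/-- A fully symmetric tensor is invariant under every permutation. -/
theorem invUnder_of_univ {T : (Fin 5 → Fin 5) → ℂ} (h : SlotInvariantOn Finset.univ T) (τ : Equiv.Perm (Fin 5)) :
    InvUnder τ T :=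
  fun v => h τ (fun i hi => absurd (Finset.mem_univ i) hi) v

/-! ### §2 The cross-swap lemma -/

/-- **CROSS-SWAP LEMMA.**  A tensor symmetric in the slots of `S`, symmetric in the slots of `Sᶜ`, and invariant under one CROSS
transposition `(c d)` with `c ∈ S`, `d ∉ S` is fully slot-symmetric: every cross transposition `(x y)` is the conjugate of `(c d)` by
`(x c)(y d)`, a product of inside swaps. -/
theorem full_of_crossSwap {S : Finset (Fin 5)} {T : (Fin 5 → Fin 5) → ℂ} (hS : SlotInvariantOn S T)
    (hSc : SlotInvariantOn Sᶜ T) {c d : Fin 5} (hc : c ∈ S) (hd : d ∉ S) (hcd : InvUnder (Equiv.swap c d) T) :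
    SlotInvariantOn Finset.univ T := by
  have cross : ∀ x y : Fin 5, x ∈ S → y ∉ S → InvUnder (Equiv.swap x y) T := by
    intro x y hx hy
    have hxc' : InvUnder (Equiv.swap x c) T := by
      by_cases hxc : x = c
      · subst hxc; rw [Equiv.swap_self]; exact fun v => by simp
      · exact invUnder_swap_of_mem hS hx hc
    have hyd' : InvUnder (Equiv.swap y d) T := by
      by_cases hyd : y = d
      · subst hyd; rw [Equiv.swap_self]; exact fun v => by simp
      · exact invUnder_swap_of_not_mem hSc hy hd
    have hcy : c ≠ y := fun h => hy (h ▸ hc)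
    have hcd' : c ≠ d := fun h => hd (h ▸ hc)
    have hyx : y ≠ x := fun h => hy (h ▸ hx)
    have hfc : (Equiv.swap x c * Equiv.swap y d) c = x := by
      rw [Equiv.Perm.mul_apply, Equiv.swap_apply_of_ne_of_ne hcy hcd', Equiv.swap_apply_right]
    have hfd : (Equiv.swap x c * Equiv.swap y d) d = y := by
      rw [Equiv.Perm.mul_apply, Equiv.swap_apply_right, Equiv.swap_apply_of_ne_of_ne hyx (Ne.symm hcy)]
    have key : Equiv.swap x y =
        (Equiv.swap x c * Equiv.swap y d) * Equiv.swap c d * (Equiv.swap x c * Equiv.swap y d)⁻¹ := by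
      rw [← Equiv.swap_apply_apply, hfc, hfd]
    rw [key]
    exact invUnder_conj (invUnder_mul hxc' hyd') hcd
  apply slotInvariantOn_univ_of_swaps
  intro x y _
  by_cases hx : x ∈ S <;> by_cases hy : y ∈ S
  · exact invUnder_swap_of_mem hS hx hy
  · exact cross x y hx hy
  · rw [Equiv.swap_comm]; exact cross y x hy hx
  · exact invUnder_swap_of_not_mem hSc hx hy

/-- A tensor symmetric within both sides of TWO distinct pair splits is fully symmetric (the `pair_cover` engine, read off
`twoSplit_separation` applied to `(D, -D)`). -/
theorem full_of_two_stabilizers (S₂ S₃ : Finset (Fin 5)) (h₂ : S₂.card = 2) (h₃ : S₃.card = 2) (h23 : S₂ ≠ S₃)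
    {D : (Fin 5 → Fin 5) → ℂ} (hD₂ : SlotInvariantOn S₂ D ∧ SlotInvariantOn S₂ᶜ D)
    (hD₃ : SlotInvariantOn S₃ D ∧ SlotInvariantOn S₃ᶜ D) : SlotInvariantOn Finset.univ D := by
  have h0 : SlotInvariantOn Finset.univ (D + -D) := fun τ _ v => by simp
  exact (twoSplit_separation S₂ S₃ h₂ h₃ h23 D (-D) hD₂ ⟨slotInvariantOn_neg hD₃.1, slotInvariantOn_neg hD₃.2⟩ h0).1

/-! ### §3 Elimination of one role -/

/-- **ELIMINATION.**  `Z₁, Z₂, Z₃` symmetric within both sides of `S₁, S₂, S₃`, `Z₁ + Z₂ + Z₃` fully symmetric, and a cross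
transposition `(c d)` of `S₃` (`c ∈ S₃`, `d ∉ S₃`) lying in the stabilisers of `S₁` and of `S₂` (both slots inside, or both
outside): then `Z₃` is fully symmetric — subtracting the sum at `v` and at `v ∘ (c d)` leaves `Z₃ (v ∘ (c d)) = Z₃ v`, and the
cross-swap lemma applies. -/
theorem full_of_role {S₁ S₂ S₃ : Finset (Fin 5)} {Z₁ Z₂ Z₃ : (Fin 5 → Fin 5) → ℂ}
    (hZ₁ : SlotInvariantOn S₁ Z₁ ∧ SlotInvariantOn S₁ᶜ Z₁) (hZ₂ : SlotInvariantOn S₂ Z₂ ∧ SlotInvariantOn S₂ᶜ Z₂)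
    (hZ₃ : SlotInvariantOn S₃ Z₃ ∧ SlotInvariantOn S₃ᶜ Z₃) (hsum : SlotInvariantOn Finset.univ (Z₁ + Z₂ + Z₃))
    {c d : Fin 5} (hc : c ∈ S₃) (hd : d ∉ S₃) (h1 : (c ∈ S₁ ∧ d ∈ S₁) ∨ (c ∉ S₁ ∧ d ∉ S₁))
    (h2 : (c ∈ S₂ ∧ d ∈ S₂) ∨ (c ∉ S₂ ∧ d ∉ S₂)) : SlotInvariantOn Finset.univ Z₃ := by
  have i1 : InvUnder (Equiv.swap c d) Z₁ :=
    h1.elim (fun h => invUnder_swap_of_mem hZ₁.1 h.1 h.2) (fun h => invUnder_swap_of_not_mem hZ₁.2 h.1 h.2)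
  have i2 : InvUnder (Equiv.swap c d) Z₂ :=
    h2.elim (fun h => invUnder_swap_of_mem hZ₂.1 h.1 h.2) (fun h => invUnder_swap_of_not_mem hZ₂.2 h.1 h.2)
  have i3 : InvUnder (Equiv.swap c d) Z₃ := invUnder_of_add_left (invUnder_of_univ hsum _) (invUnder_add i1 i2)
  exact full_of_crossSwap hZ₃.1 hZ₃.2 hc hd i3

/-- The third shadow is fully symmetric once the other two are. -/
theorem full_of_other_two {Z₁ Z₂ Z₃ : (Fin 5 → Fin 5) → ℂ} (hsum : SlotInvariantOn Finset.univ (Z₁ + Z₂ + Z₃))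
    (h1 : SlotInvariantOn Finset.univ Z₁) (h2 : SlotInvariantOn Finset.univ Z₂) : SlotInvariantOn Finset.univ Z₃ := by
  have h : Z₃ = (Z₁ + Z₂ + Z₃) - Z₁ - Z₂ := by abel
  rw [h]
  exact slotInvariantOn_sub (slotInvariantOn_sub hsum h1) h2

/-! ### §4 Every non-triangle triple of distinct pair splits -/

set_option synthInstance.maxSize 4000 in
/-- **Kernel census of the roles.**  For three distinct pair splits (indices) that are not the three sides of a triangle
(`|S₁ ∪ S₂ ∪ S₃| ≠ 3`), at least TWO of the three splits `S_k` admit a cross transposition `(c d)` (`c ∈ S_k`, `d ∉ S_k`)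
stabilising the other two splits. -/
theorem nonTriangle_roles : ∀ s₁ s₂ s₃ : Fin 10, s₁ ≠ s₂ → s₁ ≠ s₃ → s₂ ≠ s₃ →
    (pairOf s₁ ∪ pairOf s₂ ∪ pairOf s₃).card ≠ 3 →
    ((∃ c d : Fin 5, c ∈ pairOf s₁ ∧ d ∉ pairOf s₁ ∧
        ((c ∈ pairOf s₂ ∧ d ∈ pairOf s₂) ∨ (c ∉ pairOf s₂ ∧ d ∉ pairOf s₂)) ∧
        ((c ∈ pairOf s₃ ∧ d ∈ pairOf s₃) ∨ (c ∉ pairOf s₃ ∧ d ∉ pairOf s₃))) ∧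
     (∃ c d : Fin 5, c ∈ pairOf s₂ ∧ d ∉ pairOf s₂ ∧
        ((c ∈ pairOf s₁ ∧ d ∈ pairOf s₁) ∨ (c ∉ pairOf s₁ ∧ d ∉ pairOf s₁)) ∧
        ((c ∈ pairOf s₃ ∧ d ∈ pairOf s₃) ∨ (c ∉ pairOf s₃ ∧ d ∉ pairOf s₃)))) ∨
    ((∃ c d : Fin 5, c ∈ pairOf s₁ ∧ d ∉ pairOf s₁ ∧
        ((c ∈ pairOf s₂ ∧ d ∈ pairOf s₂) ∨ (c ∉ pairOf s₂ ∧ d ∉ pairOf s₂)) ∧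
        ((c ∈ pairOf s₃ ∧ d ∈ pairOf s₃) ∨ (c ∉ pairOf s₃ ∧ d ∉ pairOf s₃))) ∧
     (∃ c d : Fin 5, c ∈ pairOf s₃ ∧ d ∉ pairOf s₃ ∧
        ((c ∈ pairOf s₁ ∧ d ∈ pairOf s₁) ∨ (c ∉ pairOf s₁ ∧ d ∉ pairOf s₁)) ∧
        ((c ∈ pairOf s₂ ∧ d ∈ pairOf s₂) ∨ (c ∉ pairOf s₂ ∧ d ∉ pairOf s₂)))) ∨
    ((∃ c d : Fin 5, c ∈ pairOf s₂ ∧ d ∉ pairOf s₂ ∧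
        ((c ∈ pairOf s₁ ∧ d ∈ pairOf s₁) ∨ (c ∉ pairOf s₁ ∧ d ∉ pairOf s₁)) ∧
        ((c ∈ pairOf s₃ ∧ d ∈ pairOf s₃) ∨ (c ∉ pairOf s₃ ∧ d ∉ pairOf s₃))) ∧
     (∃ c d : Fin 5, c ∈ pairOf s₃ ∧ d ∉ pairOf s₃ ∧
        ((c ∈ pairOf s₁ ∧ d ∈ pairOf s₁) ∨ (c ∉ pairOf s₁ ∧ d ∉ pairOf s₁)) ∧
        ((c ∈ pairOf s₂ ∧ d ∈ pairOf s₂) ∨ (c ∉ pairOf s₂ ∧ d ∉ pairOf s₂)))) := by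
  decide +kernel

/-- **SEPARATION FOR NON-TRIANGLE TRIPLES.**  For three distinct pair splits that are not the three sides of a triangle and
tensors `Z_k` symmetric within both sides of `S_k` whose sum is fully slot-symmetric, each `Z_k` is fully slot-symmetric. -/
theorem threeSplit_separation_of_not_triangle (S₁ S₂ S₃ : Finset (Fin 5)) (h₁ : S₁.card = 2) (h₂ : S₂.card = 2)
    (h₃ : S₃.card = 2) (h12 : S₁ ≠ S₂) (h13 : S₁ ≠ S₃) (h23 : S₂ ≠ S₃) (htri : (S₁ ∪ S₂ ∪ S₃).card ≠ 3)
    (Z₁ Z₂ Z₃ : (Fin 5 → Fin 5) → ℂ)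
    (hZ₁ : SlotInvariantOn S₁ Z₁ ∧ SlotInvariantOn S₁ᶜ Z₁) (hZ₂ : SlotInvariantOn S₂ Z₂ ∧ SlotInvariantOn S₂ᶜ Z₂)
    (hZ₃ : SlotInvariantOn S₃ Z₃ ∧ SlotInvariantOn S₃ᶜ Z₃) (hsum : SlotInvariantOn Finset.univ (Z₁ + Z₂ + Z₃)) :
    SlotInvariantOn Finset.univ Z₁ ∧ SlotInvariantOn Finset.univ Z₂ ∧ SlotInvariantOn Finset.univ Z₃ := by
  -- pass to indices
  have e₁ := pairOf_idxOf S₁ h₁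
  have e₂ := pairOf_idxOf S₂ h₂
  have e₃ := pairOf_idxOf S₃ h₃
  have n12 : idxOf S₁ ≠ idxOf S₂ := fun h => h12 (by rw [← e₁, ← e₂, h])
  have n13 : idxOf S₁ ≠ idxOf S₃ := fun h => h13 (by rw [← e₁, ← e₃, h])
  have n23 : idxOf S₂ ≠ idxOf S₃ := fun h => h23 (by rw [← e₂, ← e₃, h])
  have H := nonTriangle_roles (idxOf S₁) (idxOf S₂) (idxOf S₃) n12 n13 n23 (by rw [e₁, e₂, e₃]; exact htri)
  rw [e₁, e₂, e₃] at H
  -- the sum in the three cyclic orders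
  have hsum₁ : SlotInvariantOn Finset.univ (Z₂ + Z₃ + Z₁) := by
    have h : Z₂ + Z₃ + Z₁ = Z₁ + Z₂ + Z₃ := by abel
    rw [h]; exact hsum
  have hsum₂ : SlotInvariantOn Finset.univ (Z₁ + Z₃ + Z₂) := by
    have h : Z₁ + Z₃ + Z₂ = Z₁ + Z₂ + Z₃ := by abel
    rw [h]; exact hsum
  -- role lemmas
  have R1 : (∃ c d : Fin 5, c ∈ S₁ ∧ d ∉ S₁ ∧ ((c ∈ S₂ ∧ d ∈ S₂) ∨ (c ∉ S₂ ∧ d ∉ S₂)) ∧ ((c ∈ S₃ ∧ d ∈ S₃) ∨ (c ∉ S₃ ∧ d ∉ S₃))) →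
      SlotInvariantOn Finset.univ Z₁ := by
    rintro ⟨c, d, hc, hd, h2, h3⟩
    exact full_of_role hZ₂ hZ₃ hZ₁ hsum₁ hc hd h2 h3
  have R2 : (∃ c d : Fin 5, c ∈ S₂ ∧ d ∉ S₂ ∧ ((c ∈ S₁ ∧ d ∈ S₁) ∨ (c ∉ S₁ ∧ d ∉ S₁)) ∧ ((c ∈ S₃ ∧ d ∈ S₃) ∨ (c ∉ S₃ ∧ d ∉ S₃))) →
      SlotInvariantOn Finset.univ Z₂ := by
    rintro ⟨c, d, hc, hd, h1, h3⟩
    exact full_of_role hZ₁ hZ₃ hZ₂ hsum₂ hc hd h1 h3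
  have R3 : (∃ c d : Fin 5, c ∈ S₃ ∧ d ∉ S₃ ∧ ((c ∈ S₁ ∧ d ∈ S₁) ∨ (c ∉ S₁ ∧ d ∉ S₁)) ∧ ((c ∈ S₂ ∧ d ∈ S₂) ∨ (c ∉ S₂ ∧ d ∉ S₂))) →
      SlotInvariantOn Finset.univ Z₃ := by
    rintro ⟨c, d, hc, hd, h1, h2⟩
    exact full_of_role hZ₁ hZ₂ hZ₃ hsum hc hd h1 h2
  rcases H with ⟨a, b⟩ | ⟨a, b⟩ | ⟨a, b⟩
  · exact ⟨R1 a, R2 b, full_of_other_two hsum (R1 a) (R2 b)⟩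
  · have s1 := R1 a
    have s3 := R3 b
    exact ⟨s1, full_of_other_two hsum₂ s1 s3, s3⟩
  · have s2 := R2 a
    have s3 := R3 b
    exact ⟨full_of_other_two hsum₁ s2 s3, s2, s3⟩

end LaplaceFiveSectorSplit

end Summit.ValiantsHypothesis.ValiantsHypothesis.Theorems.RigidityForcesSymmetryRankRigidMinimalRepr
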